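import Mathlib
import Summits.Langlands.Langlands.Theses.PicardMuOrdinary
import Literature.NumberTheory.GaloisRepresentations.CubicResidueSymbol
import Literature.NumberTheory.GaloisRepresentations.GaloisRep
import Literature.NumberTheory.Automorphic.ReciprocityGLnProofs
import Literature.NumberTheory.Automorphic.AsaiSign
import Summits.Langlands.Langlands.Theorems.PicardMuOrdinaryIrregularClassicalityPlaceOfMaximalIdeal
import Literature.NumberTheory.GaloisRepresentations.PicardCurveGaloisRep
import Literature.NumberTheory.Automorphic.BaseChangeCyclicCuspidal
import Literature.NumberTheory.Automorphic.BaseChangeStrongUnramified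
import Literature.NumberTheory.Automorphic.BaseChangeArchimedean
import Summits.Langlands.Langlands.Theorems.PicardMuOrdinaryIrregularClassicalityTwistedPicardGaloisInput
import Summits.Langlands.Langlands.Theorems.PicardMuOrdinaryIrregularClassicalityBaseChangeToL
import Summits.Langlands.Langlands.Theorems.PicardMuOrdinaryIrregularClassicalityIrregularDescentUntwist


/-!
# Line `split-ramified-prime-sqrt6` re-targeted at the RESTATED crux — a kernel-checked certificate

Lead prover-line-stmt-Langlands-13758-1 (2026-08-16, cycle 1 of the re-seated lead).  Companion of the
registered skeleton `Lines/split_ramified_prime_sqrt6.lean` (reshape r5: four sorries — two named-fact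
stubs, the INTERFACE stub `stub_polarizedTwistedTower`, the HEART `stub_twoWallOrdinaryClassicality`).

WHAT THIS FILE CERTIFIES (no `sorry`; every open obligation is an explicit hypothesis):

1. `IrregularClassicalityTwisted` — the crux with its hypothesis RESTATED in the twisted-polarized
   normal form that all three line cards, the parity note, the drefute seats (g1–g3), the disprover
   (`Disproof.lean` §13, where this `def` is copied from VERBATIM) and lead-0 request for the
   13757 → 13758 interface: primary generators `ϖ` off `S`, complex conjugation `c₀ ≠ 1`, and for
   every `k` a regular algebraic, EXACTLY conjugate-self-dual cuspidal `Π_k` on `GL₃(𝔸_K)` with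
   `N𝔭·ΣSat(Π_k,𝔭) ≡ e(a_𝔭(f)·ϖ_𝔭) (mod 3^k ℤ̄_𝔐)` off `S`.
2. `irregularClassicalityTwisted_of_picardAutomorphy` — the restated crux is still a weakening of the
   target X (so the restate opens no refutation room; Disproof §13).
3. **`irregularClassicalityTwisted_of` — THE CERTIFICATE**: the LANDED stubs of the line (Stub 1
   `stub_placeOfMaximalIdeal` p78785, Stub 2 `stub_twistedPicardGaloisInput` p92308, Stub 4
   `stub_baseChangeToL` p94426, Stub 6 `stub_irregularDescentUntwist` p94413, and the landed
   uniqueness of primary generators `primaryGen_unique`) close the RESTATED crux modulo exactly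
   (a) the Picard named fact `picardCurve_exists_lambdaAdicRep` (Upton 2009 / Serre–Tate / SGA 4½),
   (b) the Arthur–Clozel / Harris–Lan–Taylor–Thorne quadruple of named facts, and
   (c) ONE open theorem, `TwoWallOrdinaryClassicalityStmt` (= the registered heart, verbatim) —
   with NO interface stub.  I.e. after the restate the line is "closed modulo named facts + one
   open theorem", and that open theorem is the honest research content of the crux (BCGP 2025's
   announced-but-unwritten extension of Sen = Cousin classicality to `p` not totally split,
   arXiv:2502.20645 p. 3, run with two walls on the `U(2,1)_{L/L⁺}` fourfold, `L = K(√-2)`).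
4. `irregularClassicality_of_twisted_of_interface` — conversely, the CURRENT crux follows from the
   restated one plus the interface stub alone (so the registered composition factors through the
   restate: interface debt and research content are now separated by a `def`, not by a docstring).

Not formalised (remark for the tenure planner): the implication "current crux ⇒ restated crux"
(untwist a twisted-polarized tower by `ψ⁻¹` to get an unpolarized tower for `a_𝔭`) holds on paper but
needs, besides the regular-algebraic twist API, INTEGRALITY of `N𝔭·ΣSat(Π_k ⊗ ψ⁻¹, 𝔭)` — the typed
congruence `∃ t u : ℤ̄, t = N𝔭·Σα - e(a_𝔭) ∧ …` silently requires `N𝔭·Σα ∈ ℤ̄`, and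
`N𝔭·ΣSat(Π_k,𝔭)/e(ϖ_𝔭) = e(ϖ̄_𝔭)·ΣSat(Π_k,𝔭)` is integral away from `𝔭̄` only; for members of the
intended towers (integral Hecke eigenvalues) it is integral.  If the planner wants the two items to
stay formally comparable, the restated congruence can be typed as
`∃ t u : ℤ̄, (t : ℂ) = N𝔭·Σα - e(a_𝔭 f)·e(ϖ_𝔭) ∧ u ∉ 𝔐 ∧ u t ∈ (3^k)` (as below) — which is what the
intended `Π_k = P_k ⊗ ψ` satisfy with the SAME `t` as `P_k`, since `e(ϖ_𝔭) ∉ 𝔐`.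
-/

open Literature.NumberTheory.GaloisRepresentations Literature.NumberTheory.Automorphic
open IsDedekindDomain NumberField Polynomial

set_option linter.dupNamespace false

namespace Summit.Langlands.Langlands.Cruxes.IrregularClassicality.SplitRamifiedPrimeSqrt6.Restated

/-- The conclusion of the crux at `f`, `hcpt` (VERBATIM the conclusion of `IrregularClassicality` and of
the target `PicardAutomorphy`). -/
def AutomorphyConclusion (f : ℤ[X]) (hcpt : isCompact_glFiniteIntegralLevel 3 (CyclotomicField 3 ℚ)) :
    Prop :=
  ∃ (e : CyclotomicField 3 ℚ →+* ℂ) (π : CuspidalAutomorphicRepData 3 (CyclotomicField 3 ℚ) hcpt),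
    π.1.IsLAlgebraic ∧
    ∀ᶠ 𝔭 : HeightOneSpectrum (𝓞 (CyclotomicField 3 ℚ)) in Filter.cofinite,
      ∃ α : Multiset ℂ, π.1.HasSatakeParamAt 𝔭 α ∧ α.sum = e (picardTrace f 𝔭)

/-- The CURRENT hypothesis of the crux at `f`, `hcpt` (VERBATIM: the unpolarized `GL₃` tower). -/
def LimitHypothesis (f : ℤ[X]) (hcpt : isCompact_glFiniteIntegralLevel 3 (CyclotomicField 3 ℚ)) : Prop :=
  ∃ (e : CyclotomicField 3 ℚ →+* ℂ) (𝔐 : Ideal (integralClosure ℤ ℂ))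
    (S : Finset (HeightOneSpectrum (𝓞 (CyclotomicField 3 ℚ)))), 𝔐.IsMaximal ∧
    (3 : integralClosure ℤ ℂ) ∈ 𝔐 ∧
    ∀ k : ℕ, ∃ P : CuspidalAutomorphicRepData 3 (CyclotomicField 3 ℚ) hcpt, P.1.IsRegularAlgebraic ∧
      ∀ 𝔭 ∉ S, ∃ (α : Multiset ℂ) (t u : integralClosure ℤ ℂ), P.1.HasSatakeParamAt 𝔭 α ∧
        (t : ℂ) = (𝔭.residueCard : ℂ) * α.sum - e (picardTrace f 𝔭) ∧ u ∉ 𝔐 ∧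
        u * t ∈ Ideal.span {(3 : integralClosure ℤ ℂ) ^ k}

/-- **The RESTATED hypothesis** (twisted-polarized normal form; VERBATIM `Disproof.lean` §13
`TwistedPolarizedLimitHypothesis`): primary generators `ϖ` off `S` (`𝔭 = (ϖ_𝔭)`, `ϖ_𝔭 ≡ 1 mod 3`; this
forces `λ ∈ S`), complex conjugation `c₀ ≠ 1` of `K`, and for every `k` a regular algebraic cuspidal
`Π_k` on `GL₃(𝔸_K)`, EXACTLY conjugate self-dual (`IsConjSelfDualAE c₀`), with
`N𝔭·ΣSat(Π_k,𝔭) ≡ e(a_𝔭(f)·ϖ_𝔭) (mod 3^k ℤ̄_𝔐)` for every `𝔭 ∉ S` — a polarized tower for the CM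
twist `ρ'_C = ρ_C ⊗ ψ` (the object that lives on the unitary Shimura varieties; parity: `ρ_C` itself has
ODD multiplier and admits no exactly polarized regular approximants beyond depth `3`). -/
def TwistedPolarizedLimitHypothesis (f : ℤ[X])
    (hcpt : isCompact_glFiniteIntegralLevel 3 (CyclotomicField 3 ℚ)) : Prop :=
  ∃ (e : CyclotomicField 3 ℚ →+* ℂ) (𝔐 : Ideal (integralClosure ℤ ℂ))
    (S : Finset (HeightOneSpectrum (𝓞 (CyclotomicField 3 ℚ))))
    (c₀ : CyclotomicField 3 ℚ ≃ₐ[ℚ] CyclotomicField 3 ℚ)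
    (ϖ : HeightOneSpectrum (𝓞 (CyclotomicField 3 ℚ)) → 𝓞 (CyclotomicField 3 ℚ)),
    𝔐.IsMaximal ∧ (3 : integralClosure ℤ ℂ) ∈ 𝔐 ∧ c₀ ≠ 1 ∧
    (∀ 𝔭 ∉ S, 𝔭.asIdeal = Ideal.span {ϖ 𝔭} ∧ ϖ 𝔭 - 1 ∈ Ideal.span {(3 : 𝓞 (CyclotomicField 3 ℚ))}) ∧
    ∀ k : ℕ, ∃ P : CuspidalAutomorphicRepData 3 (CyclotomicField 3 ℚ) hcpt, P.1.IsRegularAlgebraic ∧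
      P.1.IsConjSelfDualAE c₀ ∧
      ∀ 𝔭 ∉ S, ∃ (α : Multiset ℂ) (t u : integralClosure ℤ ℂ), P.1.HasSatakeParamAt 𝔭 α ∧
        (t : ℂ) = (𝔭.residueCard : ℂ) * α.sum - e (↑(picardTrace f 𝔭 * ϖ 𝔭)) ∧ u ∉ 𝔐 ∧
        u * t ∈ Ideal.span {(3 : integralClosure ℤ ℂ) ^ k}

/-- **The restated crux** `IrregularClassicality⁺`: for generic `f`, a twisted-polarized tower implies
automorphy.  (This is what the line proves modulo named facts and its heart — see
`irregularClassicalityTwisted_of`.) -/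
def IrregularClassicalityTwisted : Prop :=
  ∀ (f : ℤ[X]) (hcpt : isCompact_glFiniteIntegralLevel 3 (CyclotomicField 3 ℚ)), f.natDegree = 4 →
    (f.map (Int.castRingHom ℚ)).Separable → 12 ∣ Nat.card (f.map (Int.castRingHom ℚ)).Gal →
    TwistedPolarizedLimitHypothesis f hcpt → AutomorphyConclusion f hcpt

/-- The crux as filed is, definitionally, `LimitHypothesis → AutomorphyConclusion`. [folklore] -/
theorem irregularClassicality_iff :
    Summit.Langlands.Langlands.Theses.PicardMuOrdinary.IrregularClassicality ↔
      ∀ (f : ℤ[X]) (hcpt : isCompact_glFiniteIntegralLevel 3 (CyclotomicField 3 ℚ)), f.natDegree = 4 →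
        (f.map (Int.castRingHom ℚ)).Separable → 12 ∣ Nat.card (f.map (Int.castRingHom ℚ)).Gal →
        LimitHypothesis f hcpt → AutomorphyConclusion f hcpt :=
  Iff.rfl

/-- **The restate opens no refutation room**: the restated crux is still implied by the target
`PicardAutomorphy` (it only changes the hypothesis). [folklore] -/
theorem irregularClassicalityTwisted_of_picardAutomorphy
    (hX : Summit.Langlands.Langlands.Theses.PicardMuOrdinary.PicardAutomorphy) :
    IrregularClassicalityTwisted :=
  fun f hcpt hdeg hsep hgal _ => hX f hcpt hdeg hsep hgal

/-- **The statement of the heart** (VERBATIM the registered stub `stub_twoWallOrdinaryClassicality` of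
`Lines/split_ramified_prime_sqrt6.lean`, reshape r4/r5): two-wall ordinary classicality over
`L = K(√-2)` with the Mok transfer and the signed descent `L → K` folded in — the ONE open theorem. -/
def TwoWallOrdinaryClassicalityStmt : Prop :=
    ∀ (f : ℤ[X]) (hcpt : isCompact_glFiniteIntegralLevel 3 (CyclotomicField 3 ℚ)),
      f.natDegree = 4 → (f.map (Int.castRingHom ℚ)).Separable →
      12 ∣ Nat.card (f.map (Int.castRingHom ℚ)).Gal →
    ∀ (ι : PadicAlgCl 3 ≃+* ℂ) (e : CyclotomicField 3 ℚ →+* ℂ)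
      (S₀ : Finset (HeightOneSpectrum (𝓞 (CyclotomicField 3 ℚ))))
      (ϖ : HeightOneSpectrum (𝓞 (CyclotomicField 3 ℚ)) → 𝓞 (CyclotomicField 3 ℚ))
      (ρ : FramedGaloisRep (CyclotomicField 3 ℚ) (PadicAlgCl 3) 3),
      (∀ v : HeightOneSpectrum (𝓞 (CyclotomicField 3 ℚ)),
        ((3 : ℕ) : 𝓞 (CyclotomicField 3 ℚ)) ∈ v.asIdeal → v ∈ S₀) →
      (∀ 𝔭 ∉ S₀,
        (𝔭.asIdeal = Ideal.span {ϖ 𝔭} ∧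
          ϖ 𝔭 - 1 ∈ Ideal.span {(3 : 𝓞 (CyclotomicField 3 ℚ))}) ∧
        ρ.IsUnramifiedAt 𝔭 ∧
        ∀ 𝔓 ∈ 𝔭.primesAbove, ∀ τ : Field.absoluteGaloisGroup (CyclotomicField 3 ℚ),
          IsArithFrobAt (𝓞 (CyclotomicField 3 ℚ)) τ 𝔓 →
            FramedRep.trace ρ τ⁻¹ = ι.symm (e (↑(picardTrace f 𝔭 * ϖ 𝔭)))) →
    ∀ (L : Type) [Field L] [NumberField L] [Algebra (CyclotomicField 3 ℚ) L]
      (s : L) (c : L ≃ₐ[ℚ] L) (c₀ : CyclotomicField 3 ℚ ≃ₐ[ℚ] CyclotomicField 3 ℚ)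
      (hcptL : isCompact_glFiniteIntegralLevel 3 L) (S_L : Finset (HeightOneSpectrum (𝓞 L))),
      NumberField.IsCMField L → c₀ ≠ 1 → s ^ 2 = -2 → Module.finrank (CyclotomicField 3 ℚ) L = 2 →
      c s = -s →
      (∀ x : CyclotomicField 3 ℚ,
        c (algebraMap (CyclotomicField 3 ℚ) L x) = algebraMap (CyclotomicField 3 ℚ) L (c₀ x)) →
      FramedRep.IsAbsolutelyIrreducible (ρ.restrictField L) →
      (∀ w : HeightOneSpectrum (𝓞 L), ((3 : ℕ) : 𝓞 L) ∈ w.asIdeal → w ∈ S_L) →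
      (∀ w : HeightOneSpectrum (𝓞 L), w.under (𝓞 (CyclotomicField 3 ℚ)) ∈ S₀ → w ∈ S_L) →
      (∀ k : ℕ, ∃ (P : CuspidalAutomorphicRepData 3 L hcptL)
        (r : FramedGaloisRep L (PadicAlgCl 3) 3),
        P.1.IsRegularAlgebraic ∧ P.1.IsConjSelfDualAE c ∧
        (∀ w ∉ S_L, P.1.IsUnramifiedAt w ∧ IsGaloisCompatibleAt P.1 ι r w) ∧
        ∀ g : Field.absoluteGaloisGroup L,
          ‖FramedRep.trace r g - FramedRep.trace (ρ.restrictField L) g‖ ≤ ((3 : ℝ)⁻¹) ^ k) →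
    ∃ (π' : CuspidalAutomorphicRepData 3 (CyclotomicField 3 ℚ) hcpt)
      (S' : Finset (HeightOneSpectrum (𝓞 (CyclotomicField 3 ℚ)))),
      π'.1.IsLAlgebraic ∧
      ∀ 𝔭 ∉ S', ∃ α : Multiset ℂ, π'.1.HasSatakeParamAt 𝔭 α ∧
        ρ.IsUnramifiedAt 𝔭 ∧ ρ.HasFrobCharpolyAt 𝔭 (arithFrobPolyOfSatake ι 𝔭.residueCard 1 α)

/-- **The interface stub's statement** (VERBATIM the registered `stub_polarizedTwistedTower`): the
typed unpolarized tower for `a_𝔭` ⇒ an exactly polarized regular tower for `a_𝔭·ϖ_𝔭`.  Not provable as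
typed from the crux hypothesis (a `3`-adic automorphic descent `GL₃ → U(3)` for a non-classical limit
point — a big-`R = T` statement of 13757's size); under the restate it disappears. -/
def PolarizedTwistedTowerStmt : Prop :=
  ∀ (f : ℤ[X]) (hcpt : isCompact_glFiniteIntegralLevel 3 (CyclotomicField 3 ℚ)),
    f.natDegree = 4 → (f.map (Int.castRingHom ℚ)).Separable →
    12 ∣ Nat.card (f.map (Int.castRingHom ℚ)).Gal →
  ∀ (e : CyclotomicField 3 ℚ →+* ℂ) (𝔐 : Ideal (integralClosure ℤ ℂ))
    (S S₀ : Finset (HeightOneSpectrum (𝓞 (CyclotomicField 3 ℚ))))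
    (ϖ : HeightOneSpectrum (𝓞 (CyclotomicField 3 ℚ)) → 𝓞 (CyclotomicField 3 ℚ)),
    𝔐.IsMaximal → (3 : integralClosure ℤ ℂ) ∈ 𝔐 →
    (∀ 𝔭 ∉ S₀, 𝔭.asIdeal = Ideal.span {ϖ 𝔭} ∧
      ϖ 𝔭 - 1 ∈ Ideal.span {(3 : 𝓞 (CyclotomicField 3 ℚ))}) →
    (∀ k : ℕ, ∃ P : CuspidalAutomorphicRepData 3 (CyclotomicField 3 ℚ) hcpt,
      P.1.IsRegularAlgebraic ∧
      ∀ 𝔭 ∉ S, ∃ (α : Multiset ℂ) (t u : integralClosure ℤ ℂ), P.1.HasSatakeParamAt 𝔭 α ∧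
        (t : ℂ) = (𝔭.residueCard : ℂ) * α.sum - e (picardTrace f 𝔭) ∧ u ∉ 𝔐 ∧
        u * t ∈ Ideal.span {(3 : integralClosure ℤ ℂ) ^ k}) →
  ∃ (c₀ : CyclotomicField 3 ℚ ≃ₐ[ℚ] CyclotomicField 3 ℚ)
    (S' : Finset (HeightOneSpectrum (𝓞 (CyclotomicField 3 ℚ)))), c₀ ≠ 1 ∧ S ⊆ S' ∧ S₀ ⊆ S' ∧
    ∀ k : ℕ, ∃ P : CuspidalAutomorphicRepData 3 (CyclotomicField 3 ℚ) hcpt,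
      P.1.IsRegularAlgebraic ∧ P.1.IsConjSelfDualAE c₀ ∧
      ∀ 𝔭 ∉ S', ∃ (α : Multiset ℂ) (t u : integralClosure ℤ ℂ), P.1.HasSatakeParamAt 𝔭 α ∧
        (t : ℂ) = (𝔭.residueCard : ℂ) * α.sum - e (↑(picardTrace f 𝔭 * ϖ 𝔭)) ∧ u ∉ 𝔐 ∧
        u * t ∈ Ideal.span {(3 : integralClosure ℤ ℂ) ^ k}

/-- **THE CERTIFICATE.**  The landed stubs of the line close the RESTATED crux modulo (a) the Picard
named fact, (b) the four base-change / reciprocity named facts, (c) the heart — and nothing else: no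
interface stub.  Proof: unpack the twisted-polarized tower `(e, 𝔐, S, c₀, ϖ, (Π_k))`; Stub 1 (landed)
turns `𝔐` into an adapted `ι : ℚ̄₃ ≃ ℂ`; Stub 2 (landed, conditional on (a)) gives `S₀ ⊇ {v ∣ 3}`,
primary generators `ϖ'` off `S₀` and `ρ = ρ_C ⊗ ψ` with geometric-Frobenius trace
`ι⁻¹ e(a_𝔭(f)·ϖ'_𝔭)`; by uniqueness of primary generators (`primaryGen_unique`, landed) `ϖ = ϖ'` off
`S ∪ S₀`, so the GIVEN tower is a `c₀`-polarized tower for the trace function `e(a_𝔭(f)·ϖ'_𝔭)` off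
`S ∪ S₀`; Stub 4 (landed, conditional on (b)) base-changes it to `L = K(√-2)` in Galois-convergent
form; the heart (c) makes `ρ` automorphic over `K`; Stub 6 (landed, unconditional) untwists in sum
form. [folklore] -/
theorem irregularClassicalityTwisted_of
    (hPic : Literature.NumberTheory.GaloisRepresentations.picardCurve_exists_lambdaAdicRep)
    (hBCc : baseChange_cyclic_cuspidal) (hBCu : ArthurClozel1989_strongLifting_unramified)
    (hBCa : ArthurClozel1989_strongLifting_archimedean) (hGal : exists_galoisRep_of_regularAlgebraic)
    (hHeart : TwoWallOrdinaryClassicalityStmt) :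
    IrregularClassicalityTwisted := by
  intro f hcpt hdeg hsep hgal htw
  classical
  obtain ⟨e, 𝔐, S, c₀, ϖ, h𝔐, h3, hc₀, hϖ, htower⟩ := htw
  -- Stub 1 (landed): the place 𝔐 is the place of an isomorphism ι : ℚ̄₃ ≃ ℂ
  obtain ⟨ι, hι⟩ :=
    Summit.Langlands.Langlands.Theorems.IrregularClassicality.SplitRamifiedPrimeSqrt6.stub_placeOfMaximalIdeal
      𝔐 h𝔐 h3
  -- Stub 2 (landed, conditional on the Picard named fact): S₀, primary generators ϖ', ρ = ρ_C ⊗ ψ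
  obtain ⟨S₀, ϖ', ρ, hS₀, hirr, hρ⟩ :=
    Summit.Langlands.Langlands.Theorems.IrregularClassicality.SplitRamifiedPrimeSqrt6.stub_twistedPicardGaloisInput
      hPic f hdeg hsep hgal ι e
  -- the given tower, read off `S ∪ S₀`, is a polarized tower for the trace function of ρ
  have hpol : ∀ k : ℕ, ∃ P : CuspidalAutomorphicRepData 3 (CyclotomicField 3 ℚ) hcpt,
      P.1.IsRegularAlgebraic ∧ P.1.IsConjSelfDualAE c₀ ∧
      ∀ 𝔭 ∉ S ∪ S₀, ∃ (α : Multiset ℂ) (t u : integralClosure ℤ ℂ), P.1.HasSatakeParamAt 𝔭 α ∧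
        (t : ℂ) = (𝔭.residueCard : ℂ) * α.sum - e (↑(picardTrace f 𝔭 * ϖ' 𝔭)) ∧ u ∉ 𝔐 ∧
        u * t ∈ Ideal.span {(3 : integralClosure ℤ ℂ) ^ k} := by
    intro k
    obtain ⟨P, hreg, hcsd, hP⟩ := htower k
    refine ⟨P, hreg, hcsd, fun 𝔭 h𝔭 => ?_⟩
    simp only [Finset.mem_union, not_or] at h𝔭
    obtain ⟨α, t, u, hα, ht, hu, hut⟩ := hP 𝔭 h𝔭.1
    have h𝔭3 : (3 : 𝓞 (CyclotomicField 3 ℚ)) ∉ 𝔭.asIdeal := fun h =>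
      h𝔭.2 (hS₀ 𝔭 (by rwa [Nat.cast_ofNat]))
    have hϖeq : ϖ 𝔭 = ϖ' 𝔭 :=
      Summit.Langlands.Langlands.Theorems.IrregularClassicality.SplitRamifiedPrimeSqrt6.primaryGen_unique
        h𝔭3 (hϖ 𝔭 h𝔭.1).1 (hρ 𝔭 h𝔭.2).1.1 (hϖ 𝔭 h𝔭.1).2 (hρ 𝔭 h𝔭.2).1.2
    exact ⟨α, t, u, hα, by rw [← hϖeq]; exact ht, hu, hut⟩
  -- Stub 4 (landed, conditional on the base-change / reciprocity facts): base change to L = K(√-2)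
  obtain ⟨L, _instF, _instNF, _instA, s, c, hcptL, S_L, hCM, hs, hdegL, hcs, hcc₀, hSL3, hSLS₀,
      htowerL⟩ :=
    Summit.Langlands.Langlands.Theorems.IrregularClassicality.SplitRamifiedPrimeSqrt6.stub_baseChangeToL
      hBCc hBCu hBCa hGal 𝔐 h𝔐 h3 ι hι hcpt c₀ hc₀ (S ∪ S₀) S₀
      (fun 𝔭 => e (↑(picardTrace f 𝔭 * ϖ' 𝔭))) ρ hS₀ (fun 𝔭 h𝔭 => (hρ 𝔭 h𝔭).2) hpol
  -- the heart: ρ is automorphic over K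
  obtain ⟨π', S'', hLalg, hcompat⟩ :=
    hHeart f hcpt hdeg hsep hgal ι e S₀ ϖ' ρ hS₀ hρ L s c c₀ hcptL S_L hCM hc₀ hs hdegL hcs hcc₀
      (hirr L hdegL) hSL3 hSLS₀ htowerL
  -- Stub 6 (landed, unconditional): untwist, in sum form
  obtain ⟨πK, hKalg, hev⟩ :=
    Summit.Langlands.Langlands.Theorems.IrregularClassicality.SplitRamifiedPrimeSqrt6.stub_irregularDescentUntwist
      f hcpt hdeg hsep hgal ι e S₀ ϖ' ρ hS₀ hρ π' S'' hLalg hcompat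
  exact ⟨e, πK, hKalg, hev⟩

/-- **Conversely, the crux AS FILED = the restated crux + the interface stub** (given the Picard named
fact, which supplies the primary generators `ϖ` the interface stub is stated with).  So the registered
composition `IrregularClassicality_of` factors: research content (`IrregularClassicalityTwisted`) and
interface debt (`PolarizedTwistedTowerStmt`) are separated. [folklore] -/
theorem irregularClassicality_of_twisted_of_interface
    (hPic : Literature.NumberTheory.GaloisRepresentations.picardCurve_exists_lambdaAdicRep)
    (hTw : IrregularClassicalityTwisted) (hInt : PolarizedTwistedTowerStmt) :
    Summit.Langlands.Langlands.Theses.PicardMuOrdinary.IrregularClassicality := by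
  intro f hcpt hdeg hsep hgal hlim
  classical
  obtain ⟨e, 𝔐, S, h𝔐, h3, htower⟩ := hlim
  -- primary generators off some S₀ ⊇ {v ∣ 3} (from the landed Stub 2; any ι will do)
  obtain ⟨ι, -⟩ :=
    Summit.Langlands.Langlands.Theorems.IrregularClassicality.SplitRamifiedPrimeSqrt6.stub_placeOfMaximalIdeal
      𝔐 h𝔐 h3
  obtain ⟨S₀, ϖ, ρ, hS₀, -, hρ⟩ :=
    Summit.Langlands.Langlands.Theorems.IrregularClassicality.SplitRamifiedPrimeSqrt6.stub_twistedPicardGaloisInput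
      hPic f hdeg hsep hgal ι e
  obtain ⟨c₀, S', hc₀, hSS', hS₀S', hpol⟩ :=
    hInt f hcpt hdeg hsep hgal e 𝔐 S S₀ ϖ h𝔐 h3 (fun 𝔭 h𝔭 => (hρ 𝔭 h𝔭).1) htower
  refine hTw f hcpt hdeg hsep hgal ⟨e, 𝔐, S', c₀, ϖ, h𝔐, h3, hc₀, fun 𝔭 h𝔭 => ?_, hpol⟩
  exact (hρ 𝔭 (fun h => h𝔭 (hS₀S' h))).1

end Summit.Langlands.Langlands.Cruxes.IrregularClassicality.SplitRamifiedPrimeSqrt6.Restated
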